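import Summits.QuantumFields.QCD.Theorems.QuarksAsStableActionStableActionBridgeStubSymAPOsFormEqPairing
import Summits.QuantumFields.YangMills.Theorems.LangevinControlUVOSLegsAtWeakCouplingCStubRopeCutoff
import Literature.MathematicalPhysics.QuantumFieldTheory.OSReconstructionNoE1
import Literature.MathematicalPhysics.QuantumLattice.SchwingerOSCluster
import Literature.MathematicalPhysics.QuantumFieldTheory.SchwingerLimitInheritance
import HarnessLib

/-!
# Stub `stub_rpOfSymThermal` of line `Sketch` (crux `QuarksAsStableAction.StableActionBridge`, stmt-QuantumFields-9737, reshape r3e):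
# eventual approximate OS positivity of the thermal Θ-symmetrised lattice distributions — P8 as a THEOREM

The r3c/r3d lattice packages of the line ASSUMED clause P8 (eventually approximately positive Osterwalder–Schrader forms of the
lattice functional).  On the thermal (time-antiperiodic) functional with Θ-symmetrised insertions (Defs file,
`qcdLatticeDistSymAP`) it is a consequence of the tree\'s site-reflection positivity, of the wave-3 theorems
`stub_symAP_osForm_eq_pairing` (the OS form of a finite family IS the thermal pairing `⟨X · ΘX⟩_AP` of the smeared observable
`symSmearedObs`) and `stub_symAP_pairing_nonneg` (that pairing is `≥ 0` with vanishing imaginary part when the test functions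
live at lattice times `2 ≤ t ≤ L_k − 1`), and of the package\'s own k-uniform E0′ bound P2:

* `latticeTime_window_of_physical`, `eventually_window` — a compact physical-time window `[θ, Θ] ⊂ (0, ∞)` sits inside the
  lattice-time window `2 ≤ t ≤ L_k − 1` eventually in `k` (`a_k → 0`, `a_k L_k → ∞`);
* `exists_pos_le_times_of_isCompact`, `times_le_of_mem_closedBall` — compactly supported time-ordered test functions have
  such a window;
* `osForm_nonneg_of_denominator_eq_zero` — the junk branch `Z_AP = 0`: all weights of positive degree vanish and the form is
  the Gram square of the degree-`0` constants;
* `stub_rpOfSymThermal` — for every finite time-ordered family and `ε > 0`, eventually in `k` the OS form has real part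
  `≥ −ε` and imaginary part `≤ ε` in modulus: approximate each `Fⱼ` in `𝓢` by compact cutoffs inside its support
  (`exists_offDiagonal_cutoff_tendsto\'`), whose appended witnesses converge (`SchwartzMap.tendsto_appendTensor`,
  `continuous_osAdjoint`) and whose forms are exactly non-negative, and bound the difference by P2
  (`OSReconstructionNoE1.isOffDiagonal_appendTensor_osAdjoint` keeps everything in `⁰𝒮`).

References: Osterwalder–Schrader 1973 §2 (E2); Osterwalder–Seiler 1978 §2–§3; Glimm–Jaffe 1987 §6.1.
-/

noncomputable section

open Filter Topology ComplexConjugate MeasureTheory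
open scoped SchwartzMap BigOperators
open Literature.MathematicalPhysics.AQFT Literature.MathematicalPhysics.QuantumLattice
open Literature.MathematicalPhysics.QuantumLattice.GrassmannAlgebra
open Literature.MathematicalPhysics.QuantumFieldTheory
open Literature.Probability.LatticeModels (box Site)

namespace Summit.QuantumFields.QCD.Cruxes.StableActionBridge.Sketch

section RpAssembly

variable {Nf : ℕ}

/-- A physical-time window `[θ, Θ]` with `2a ≤ θ` and `Θ ≤ a (L − 1)` is the lattice-time window `2 ≤ t ≤ L − 1`. -/
theorem latticeTime_window_of_physical {a θ Θ : ℝ} {L : ℕ} (ha : 0 < a) (h2 : 2 * a ≤ θ)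
    (hΘ : Θ ≤ a * ((L : ℝ) - 1)) {t : ℤ} (hθt : θ ≤ a * t) (htΘ : a * t ≤ Θ) :
    2 ≤ t ∧ t + 1 ≤ (L : ℤ) := by
  constructor
  · have h : a * 2 ≤ a * t := by linarith
    have h' : (2 : ℝ) ≤ t := le_of_mul_le_mul_left h ha
    exact_mod_cast h'
  · have h : a * t ≤ a * ((L : ℝ) - 1) := htΘ.trans hΘ
    have h' : (t : ℝ) ≤ (L : ℝ) - 1 := le_of_mul_le_mul_left h ha
    have h'' : (t : ℝ) + 1 ≤ (L : ℝ) := by linarith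
    exact_mod_cast h''

/-- **Eventually the lattice covers any compact physical-time window**: `2a_k ≤ θ`, `Θ ≤ a_k (L_k − 1)` and `1 ≤ L_k`
eventually in `k`, for every `θ > 0` and `Θ ≥ 0` (`a_k → 0`, `a_k L_k → ∞`). -/
theorem eventually_window (sch : QCDScheme Nf) {θ Θ : ℝ} (hθ : 0 < θ) (hΘ : 0 ≤ Θ) :
    ∀ᶠ k in atTop, 2 * sch.a k ≤ θ ∧ Θ ≤ sch.a k * ((sch.L k : ℝ) - 1) ∧ 1 ≤ sch.L k := by
  have ha : Tendsto (fun k => 2 * sch.a k) atTop (𝓝 0) := by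
    simpa using sch.tendsto_a.const_mul 2
  have h1 : ∀ᶠ k in atTop, 2 * sch.a k ≤ θ := ha.eventually (eventually_le_nhds hθ)
  have h2 : ∀ᶠ k in atTop, Θ + 1 ≤ sch.a k * sch.L k := Filter.tendsto_atTop.1 sch.tendsto_L (Θ + 1)
  have h3 : ∀ᶠ k in atTop, sch.a k ≤ 1 := sch.tendsto_a.eventually (eventually_le_nhds one_pos)
  filter_upwards [h1, h2, h3] with k hk1 hk2 hk3
  have hapos := sch.a_pos k
  refine ⟨hk1, ?_, ?_⟩
  · have : sch.a k * ((sch.L k : ℝ) - 1) = sch.a k * sch.L k - sch.a k := by ring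
    rw [this]
    linarith
  · by_contra hL
    push Not at hL
    have hL0 : sch.L k = 0 := by omega
    rw [hL0, Nat.cast_zero, mul_zero] at hk2
    linarith

/-- **A uniform positive lower time bound on a compact time-ordered support.**  If `K` is compact and every point of `K` has
all its times positive, some `θ > 0` bounds all times of all points of `K` from below. -/
theorem exists_pos_le_times_of_isCompact {n : ℕ} {K : Set (Fin n → EuclideanSpace ℝ (Fin 4))} (hK : IsCompact K)
    (hpos : ∀ x ∈ K, ∀ i, 0 < x i 0) : ∃ θ : ℝ, 0 < θ ∧ ∀ x ∈ K, ∀ i, θ ≤ x i 0 := by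
  classical
  -- one coordinate at a time, then the minimum over the finitely many coordinates
  have hcoord : ∀ i : Fin n, ∃ θ : ℝ, 0 < θ ∧ ∀ x ∈ K, θ ≤ x i 0 := by
    intro i
    by_cases hne : K.Nonempty
    · have hcont : ContinuousOn (fun x : Fin n → EuclideanSpace ℝ (Fin 4) => x i 0) K :=
        ((EuclideanSpace.proj (0 : Fin 4)).continuous.comp (continuous_apply i)).continuousOn
      obtain ⟨x₀, hx₀, hmin⟩ := hK.exists_isMinOn hne hcont
      exact ⟨x₀ i 0, hpos x₀ hx₀ i, fun x hx => hmin hx⟩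
    · exact ⟨1, one_pos, fun x hx => (hne ⟨x, hx⟩).elim⟩
  choose θ hθpos hθle using hcoord
  by_cases hn : n = 0
  · subst hn
    exact ⟨1, one_pos, fun x _ i => i.elim0⟩
  · have hne : (Finset.univ : Finset (Fin n)).Nonempty := Finset.univ_nonempty_iff.2 ⟨⟨0, Nat.pos_of_ne_zero hn⟩⟩
    refine ⟨Finset.univ.inf' hne θ, (Finset.lt_inf'_iff hne).2 fun i _ => hθpos i, fun x hx i => ?_⟩
    exact (Finset.inf'_le θ (Finset.mem_univ i)).trans (hθle i x hx)

/-- Times of points in a closed ball are bounded by its radius. -/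
theorem times_le_of_mem_closedBall {n : ℕ} {R : ℝ} {x : Fin n → EuclideanSpace ℝ (Fin 4)}
    (hx : x ∈ Metric.closedBall (0 : Fin n → EuclideanSpace ℝ (Fin 4)) R) (i : Fin n) : x i 0 ≤ R := by
  rw [Metric.mem_closedBall, dist_zero_right] at hx
  calc x i 0 ≤ |x i 0| := le_abs_self _
    _ = ‖x i 0‖ := (Real.norm_eq_abs _).symm
    _ ≤ ‖x i‖ := PiLp.norm_apply_le (x i) 0
    _ ≤ ‖x‖ := norm_le_pi_norm x i
    _ ≤ R := hx

/-- **The junk branch**: if the thermal denominator at step `k` vanishes, all weights of positive degree are `0` (division by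
zero), so the OS form of any appended family is the Gram square `|Σ_{deg j = 0} Gⱼ(pt)|²`: real part `≥ 0`, imaginary part `0`. -/
theorem osForm_nonneg_of_denominator_eq_zero (sch : QCDScheme Nf) (k : ℕ)
    (hZ : (∫ U, fermiIntegral (fermiBoltzmannAP U fun fl => sch.mq fl k) ∂(qcdGaugeMeasure sch k)) = 0)
    {N : ℕ} (deg : Fin N → ℕ) (lab : (j : Fin N) → Fin (deg j) → QCDField Nf)
    (G : (j : Fin N) → 𝓢((Fin (deg j) → EuclideanSpace ℝ (Fin 4)), ℂ))
    (H : (i j : Fin N) → 𝓢((Fin (deg i + deg j) → EuclideanSpace ℝ (Fin 4)), ℂ))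
    (hH : ∀ i j, IsAppendTensorOf (H i j) (osAdjoint (G i)) (G j)) :
    0 ≤ (∑ i, ∑ j, qcdLatticeDistSymAP sch k (deg i + deg j) (Fin.append (lab i ∘ Fin.rev) (lab j)) (H i j)).re ∧
      (∑ i, ∑ j, qcdLatticeDistSymAP sch k (deg i + deg j) (Fin.append (lab i ∘ Fin.rev) (lab j)) (H i j)).im = 0 := by
  classical
  -- all weights vanish
  have hW : ∀ {n : ℕ} (σ : Fin n → QCDField Nf) (x : Fin n → Site 4), qcdTorusMomentSymAP sch k σ x = 0 := by
    intro n σ x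
    unfold qcdTorusMomentSymAP qcdTorusExpectAP
    have hZ' : (∫ U, fermiIntegral (fermiBoltzmannAP U fun fl => sch.mq fl k)
        ∂(wilsonMeasure (d := 4) (L := sch.side k) (fundamentalRep (Fin 3)) (sch.β k))) = 0 := by
      simpa only [qcdGaugeMeasure] using hZ
    rw [hZ', div_zero]
  -- hence the distributions are point evaluation in degree 0 and 0 otherwise
  have hΛ : ∀ {n : ℕ} (σ : Fin n → QCDField Nf) (F : 𝓢((Fin n → EuclideanSpace ℝ (Fin 4)), ℂ)),
      qcdLatticeDistSymAP sch k n σ F = if n = 0 then F default else 0 := by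
    intro n σ F
    by_cases hn : n = 0
    · subst hn
      rw [if_pos rfl, qcdLatticeDistSymAP_zero_apply]
    · rw [if_neg hn, qcdLatticeDistSymAP_apply sch k hn]
      exact Finset.sum_eq_zero fun x _ => by rw [hW, zero_mul]
  -- the degree-0 values
  set v : Fin N → ℂ := fun j => qcdLatticeDistSymAP sch k (deg j) (lab j) (G j) with hv
  have hterm : ∀ i j, qcdLatticeDistSymAP sch k (deg i + deg j) (Fin.append (lab i ∘ Fin.rev) (lab j)) (H i j) =
      conj (v i) * v j := by
    intro i j
    rw [hΛ, hv]
    simp only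
    rw [hΛ (lab i), hΛ (lab j)]
    by_cases hi : deg i = 0
    · by_cases hj : deg j = 0
      · have hij : deg i + deg j = 0 := by omega
        rw [if_pos hij, if_pos hi, if_pos hj, hH i j default, osAdjoint_apply]
        haveI : IsEmpty (Fin (deg i)) := by rw [hi]; infer_instance
        haveI : IsEmpty (Fin (deg j)) := by rw [hj]; infer_instance
        exact congrArg₂ (fun p q => conj (G i p) * G j q) (Subsingleton.elim _ _) (Subsingleton.elim _ _)
      · have hij : deg i + deg j ≠ 0 := by omega
        rw [if_neg hij, if_neg hj, mul_zero]
    · have hij : deg i + deg j ≠ 0 := by omega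
      rw [if_neg hij, if_neg hi, map_zero, zero_mul]
  simp_rw [hterm]
  have hsq : (∑ i, ∑ j, conj (v i) * v j) = conj (∑ i, v i) * ∑ j, v j := by
    rw [map_sum, Finset.sum_mul]
    exact Finset.sum_congr rfl fun i _ => by rw [Finset.mul_sum]
  rw [hsq, Complex.conj_mul', ← Complex.ofReal_pow, Complex.ofReal_re, Complex.ofReal_im]
  exact ⟨by positivity, rfl⟩

/-- **The lead's registered stub `stub_rpOfSymThermal`, PROVED in-skeleton modulo the wave-3 stubs ( eventual approximate OS positivity of the symmetrised thermal distributions — P8 as a THEOREM).**  (Lands as a Theorems file once `stub_symAP_osForm_eq_pairing` and `stub_symAP_pairing_nonneg` land.)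
Along a scheme with eventually physical couplings and a k-uniform E0′ bound on `⁰𝒮` (the package's own P2), every finite
time-ordered family has OS forms with real part `≥ −ε` and imaginary part `≤ ε` in modulus, eventually in `k`: approximate each
`Fⱼ` in `𝓢` by compactly supported cutoffs inside its support (`exists_offDiagonal_cutoff_tendsto'`; they live at times in a
compact `[θ, Θ] ⊂ (0, ∞)`, hence at lattice times `2 ≤ t ≤ L_k − 1` once `2a_k ≤ θ` and `Θ ≤ a_k (L_k − 1)`), whose forms are
exactly non-negative (`stub_symAP_osForm_eq_pairing` + `stub_symAP_pairing_nonneg`; the junk branch `Z_AP = 0` is a Gram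
matrix of constants), and control the difference by P2 and the joint continuity of `(F, G) ↦ ΘF* ⊗ G`
(`continuous_appendTensor`, `continuous_osAdjoint`). [difficulty: L] [cite: OsterwalderSchraderCMP1973, §2 (E2)] -/
theorem stub_rpOfSymThermal : ∀ {Nf : ℕ} (sch : QCDScheme Nf), (∀ᶠ k in atTop, 0 ≤ sch.β k) →
    (∀ fl : Fin Nf, ∀ᶠ k in atTop, -1 < sch.mq fl k) →
    ∀ {s : ℕ} {α β : ℝ}, (∀ (n : ℕ) (σ : Fin n → QCDField Nf), ∀ᶠ k in atTop, ∀ F : 𝓢((Fin n → EuclideanSpace ℝ (Fin 4)), ℂ),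
      IsOffDiagonal F → ‖qcdLatticeDistSymAP sch k n σ F‖ ≤ α * (n.factorial : ℝ) ^ β * schwartzNorm (n * s) F) →
    ∀ (N : ℕ) (deg : Fin N → ℕ) (lab : (j : Fin N) → Fin (deg j) → QCDField Nf)
      (F : (j : Fin N) → 𝓢((Fin (deg j) → EuclideanSpace ℝ (Fin 4)), ℂ)), (∀ j, IsTimeOrdered (F j)) →
      ∀ H : (i j : Fin N) → 𝓢((Fin (deg i + deg j) → EuclideanSpace ℝ (Fin 4)), ℂ),
        (∀ i j, IsAppendTensorOf (H i j) (osAdjoint (F i)) (F j)) →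
        ∀ ε : ℝ, 0 < ε → ∀ᶠ l in atTop,
          -ε ≤ (∑ i, ∑ j, qcdLatticeDistSymAP sch l (deg i + deg j) (Fin.append (lab i ∘ Fin.rev) (lab j)) (H i j)).re ∧
          |(∑ i, ∑ j, qcdLatticeDistSymAP sch l (deg i + deg j) (Fin.append (lab i ∘ Fin.rev) (lab j)) (H i j)).im| ≤ ε := by
  intro Nf sch hβ hbr s α β hb N deg lab F hF H hH ε hε
  classical
  -- notation for the forms (an opaque abbreviation with its defining equation)
  obtain ⟨Λ, hΛdef⟩ : ∃ Λ : ℕ → (i j : Fin N) → 𝓢((Fin (deg i + deg j) → EuclideanSpace ℝ (Fin 4)), ℂ) → ℂ,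
      Λ = fun l i j E => qcdLatticeDistSymAP sch l (deg i + deg j) (Fin.append (lab i ∘ Fin.rev) (lab j)) E := ⟨_, rfl⟩
  have hΛ : ∀ l i j E, qcdLatticeDistSymAP sch l (deg i + deg j) (Fin.append (lab i ∘ Fin.rev) (lab j)) E = Λ l i j E :=
    fun l i j E => by rw [hΛdef]
  simp_rw [hΛ]
  -- (1) compact cutoffs inside the supports
  have hFo : ∀ j, IsOffDiagonal (F j) := fun j => (hF j).isOffDiagonal
  have hcut : ∀ j : Fin N, ∃ u : ℕ → 𝓢((Fin (deg j) → EuclideanSpace ℝ (Fin 4)), ℂ),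
      (∀ m : ℕ, tsupport (u m : (Fin (deg j) → EuclideanSpace ℝ (Fin 4)) → ℂ) ⊆
        tsupport (F j : (Fin (deg j) → EuclideanSpace ℝ (Fin 4)) → ℂ) ∩
          Metric.closedBall (0 : Fin (deg j) → EuclideanSpace ℝ (Fin 4)) (2 * ((m : ℝ) + 1))) ∧
      (∀ m, IsOffDiagonal (u m)) ∧ Tendsto u atTop (𝓝 (F j)) := fun j =>
    Summit.QuantumFields.YangMills.Theorems.OSLegsFromFemtoAndGap.exists_offDiagonal_cutoff_tendsto' (F j) (hFo j)
  choose u hu_supp _hu_off hu_lim using hcut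
  have hu_to : ∀ j m, IsTimeOrdered (u j m) := fun j m =>
    ((hu_supp j m).trans Set.inter_subset_left).trans (hF j)
  -- (2) the appended witnesses and their convergence
  have hHeq : ∀ i j, H i j = (osAdjoint (F i)).appendTensor (F j) := fun i j => by
    ext x; rw [hH i j x, SchwartzMap.appendTensor_apply]
  obtain ⟨Hm, hHmdef⟩ : ∃ Hm : ℕ → (i j : Fin N) → 𝓢((Fin (deg i + deg j) → EuclideanSpace ℝ (Fin 4)), ℂ),
      Hm = fun m i j => (osAdjoint (u i m)).appendTensor (u j m) := ⟨_, rfl⟩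
  have hHm_app : ∀ m i j, IsAppendTensorOf (Hm m i j) (osAdjoint (u i m)) (u j m) := fun m i j => by
    rw [hHmdef]; exact isAppendTensorOf_appendTensor _ _
  have hHlim : ∀ i j, Tendsto (fun m => Hm m i j) atTop (𝓝 (H i j)) := by
    intro i j
    rw [hHeq, hHmdef]
    exact SchwartzMap.tendsto_appendTensor ((continuous_osAdjoint.tendsto (F i)).comp (hu_lim i)) (hu_lim j)
  -- (3) choose the cutoff level `m`: the Schwartz-norm errors are small
  obtain ⟨C, hCdef⟩ : ∃ C : Fin N → Fin N → ℝ, C = fun i j => |α| * ((deg i + deg j).factorial : ℝ) ^ β := ⟨_, rfl⟩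
  obtain ⟨M, hMdef⟩ : ∃ M : Fin N → Fin N → ℕ, M = fun i j => (deg i + deg j) * s := ⟨_, rfl⟩
  have hsmall : ∀ᶠ m in atTop, ∀ i j, C i j * schwartzNorm (M i j) (H i j - Hm m i j) < ε / (2 * ((N : ℝ) + 1) ^ 2) := by
    have hδ : 0 < ε / (2 * ((N : ℝ) + 1) ^ 2) := by positivity
    refine (eventually_all.2 fun i => eventually_all.2 fun j => ?_)
    have hqc : Continuous fun E : 𝓢((Fin (deg i + deg j) → EuclideanSpace ℝ (Fin 4)), ℂ) =>
        C i j * schwartzNorm (M i j) (H i j - E) :=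
      continuous_const.mul ((Seminorm.continuous_finsetSup (s := Finset.Iic (M i j, M i j)) fun q _ =>
        (schwartz_withSeminorms ℂ (Fin (deg i + deg j) → EuclideanSpace ℝ (Fin 4)) ℂ).continuous_seminorm q).comp
          (continuous_const.sub continuous_id))
    have h0 : C i j * schwartzNorm (M i j) (H i j - H i j) = 0 := by
      have hz : schwartzNorm (M i j) (0 : 𝓢((Fin (deg i + deg j) → EuclideanSpace ℝ (Fin 4)), ℂ)) = 0 := map_zero _
      rw [sub_self, hz, mul_zero]
    have ht := (hqc.tendsto (H i j)).comp (hHlim i j)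
    rw [h0] at ht
    exact ht.eventually (eventually_lt_nhds hδ)
  obtain ⟨m, hm⟩ := hsmall.exists
  -- (4) the physical-time window of the cutoffs at level `m`
  have hwin : ∃ θ Θ : ℝ, 0 < θ ∧ 0 ≤ Θ ∧ ∀ j, ∀ x ∈ tsupport (u j m : (Fin (deg j) → EuclideanSpace ℝ (Fin 4)) → ℂ),
      ∀ i, θ ≤ x i 0 ∧ x i 0 ≤ Θ := by
    have hK : ∀ j, IsCompact (tsupport (u j m : (Fin (deg j) → EuclideanSpace ℝ (Fin 4)) → ℂ)) := fun j =>
      (isCompact_closedBall (0 : Fin (deg j) → EuclideanSpace ℝ (Fin 4)) (2 * ((m : ℝ) + 1))).of_isClosed_subset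
        (isClosed_tsupport _) ((hu_supp j m).trans Set.inter_subset_right)
    have hθj : ∀ j, ∃ θ : ℝ, 0 < θ ∧ ∀ x ∈ tsupport (u j m : (Fin (deg j) → EuclideanSpace ℝ (Fin 4)) → ℂ),
        ∀ i, θ ≤ x i 0 := fun j =>
      exists_pos_le_times_of_isCompact (hK j) fun x hx i => ((hu_to j m) hx).1 i
    choose θ hθpos hθle using hθj
    refine ⟨if hN : N = 0 then 1 else Finset.univ.inf' (Finset.univ_nonempty_iff.2 ⟨⟨0, Nat.pos_of_ne_zero hN⟩⟩) θ,
      2 * ((m : ℝ) + 1), ?_, by positivity, fun j x hx i => ⟨?_, ?_⟩⟩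
    · split_ifs with hN
      · exact one_pos
      · exact (Finset.lt_inf'_iff _).2 fun j _ => hθpos j
    · have hN : N ≠ 0 := fun h => (h ▸ j).elim0
      rw [dif_neg hN]
      exact (Finset.inf'_le θ (Finset.mem_univ j)).trans (hθle j x hx i)
    · exact times_le_of_mem_closedBall ((hu_supp j m).trans Set.inter_subset_right hx) i
  obtain ⟨θ, Θ, hθ, hΘ, hwinj⟩ := hwin
  -- (5) eventualities in `l`
  have hbound : ∀ᶠ l in atTop, ∀ i j, ∀ E : 𝓢((Fin (deg i + deg j) → EuclideanSpace ℝ (Fin 4)), ℂ), IsOffDiagonal E →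
      ‖Λ l i j E‖ ≤ C i j * schwartzNorm (M i j) E := by
    refine eventually_all.2 fun i => eventually_all.2 fun j => ?_
    filter_upwards [hb (deg i + deg j) (Fin.append (lab i ∘ Fin.rev) (lab j))] with l hl E hE
    rw [← hΛ, hCdef, hMdef]
    dsimp only
    refine (hl E hE).trans ?_
    gcongr
    · exact apply_nonneg _ _
    · exact le_abs_self α
  have hmq : ∀ᶠ l in atTop, ∀ fl, -1 < sch.mq fl l := eventually_all.2 hbr
  filter_upwards [hbound, hβ, hmq, eventually_window sch hθ hΘ] with l hl hβl hmql ⟨h2a, hΘa, hL1⟩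
  -- (6) exact positivity of the cutoff forms at step `l`
  have hP : 0 ≤ (∑ i, ∑ j, Λ l i j (Hm m i j)).re ∧ (∑ i, ∑ j, Λ l i j (Hm m i j)).im = 0 := by
    by_cases hZ : (∫ U, fermiIntegral (fermiBoltzmannAP U fun fl => sch.mq fl l) ∂(qcdGaugeMeasure sch l)) = 0
    · simpa only [hΛ] using osForm_nonneg_of_denominator_eq_zero sch l hZ deg lab (fun j => u j m) (Hm m) (hHm_app m)
    · have hsupp : ∀ (j : Fin N) (y : Fin (deg j) → Site 4), (∃ i, ¬ (2 ≤ y i 0 ∧ y i 0 + 1 ≤ (sch.L l : ℤ))) →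
          u j m (fun i => sch.a l • siteToE (y i)) = 0 := by
        intro j y ⟨i, hi⟩
        by_contra hne
        have hx : (fun i => sch.a l • siteToE (y i)) ∈
            tsupport (u j m : (Fin (deg j) → EuclideanSpace ℝ (Fin 4)) → ℂ) := subset_tsupport _ hne
        obtain ⟨hlo, hhi⟩ := hwinj j _ hx i
        have hcoord : (sch.a l • siteToE (y i)) 0 = sch.a l * (y i 0 : ℝ) := by
          rw [PiLp.smul_apply, siteToE_apply, smul_eq_mul]
        rw [hcoord] at hlo hhi
        exact hi (latticeTime_window_of_physical (sch.a_pos l) h2a hΘa hlo hhi)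
      have heq := stub_symAP_osForm_eq_pairing sch l hZ deg lab (fun j => u j m) (Hm m) (hHm_app m)
      have hnn := stub_symAP_pairing_nonneg sch l hβl hmql hL1 deg lab (fun j => u j m) hsupp
      simp only [← hΛ]
      rw [heq]
      exact hnn
  -- (7) the error of the cutoff
  have herr : ‖(∑ i, ∑ j, Λ l i j (H i j)) - ∑ i, ∑ j, Λ l i j (Hm m i j)‖ ≤ ε / 2 := by
    have hdiff : (∑ i, ∑ j, Λ l i j (H i j)) - ∑ i, ∑ j, Λ l i j (Hm m i j) =
        ∑ i, ∑ j, Λ l i j (H i j - Hm m i j) := by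
      rw [← Finset.sum_sub_distrib]
      refine Finset.sum_congr rfl fun i _ => ?_
      rw [← Finset.sum_sub_distrib]
      refine Finset.sum_congr rfl fun j _ => ?_
      simp only [← hΛ, map_sub]
    rw [hdiff]
    have hoff : ∀ i j, IsOffDiagonal (H i j - Hm m i j) := fun i j => by
      rw [hHeq, hHmdef]
      exact (OSReconstructionNoE1.isOffDiagonal_appendTensor_osAdjoint (hF i) (hF j)).sub
        (OSReconstructionNoE1.isOffDiagonal_appendTensor_osAdjoint (hu_to i m) (hu_to j m))
    calc ‖∑ i, ∑ j, Λ l i j (H i j - Hm m i j)‖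
        ≤ ∑ i, ‖∑ j, Λ l i j (H i j - Hm m i j)‖ := norm_sum_le _ _
      _ ≤ ∑ i, ∑ j, ‖Λ l i j (H i j - Hm m i j)‖ := Finset.sum_le_sum fun i _ => norm_sum_le _ _
      _ ≤ ∑ i, ∑ j, C i j * schwartzNorm (M i j) (H i j - Hm m i j) :=
          Finset.sum_le_sum fun i _ => Finset.sum_le_sum fun j _ => hl i j _ (hoff i j)
      _ ≤ ∑ _i : Fin N, ∑ _j : Fin N, ε / (2 * ((N : ℝ) + 1) ^ 2) :=
          Finset.sum_le_sum fun i _ => Finset.sum_le_sum fun j _ => (hm i j).le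
      _ = (N : ℝ) ^ 2 * (ε / (2 * ((N : ℝ) + 1) ^ 2)) := by
          simp only [Finset.sum_const, Finset.card_univ, Fintype.card_fin, nsmul_eq_mul]; ring
      _ ≤ ((N : ℝ) + 1) ^ 2 * (ε / (2 * ((N : ℝ) + 1) ^ 2)) := by gcongr; linarith
      _ = ε / 2 := by field_simp
      _ ≤ ε / 2 := le_rfl
  -- (8) conclusion
  set S := ∑ i, ∑ j, Λ l i j (H i j) with hSdef
  set P := ∑ i, ∑ j, Λ l i j (Hm m i j) with hPdef
  have hre : (P - S).re ≤ ‖P - S‖ := Complex.re_le_norm _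
  have him : |(S - P).im| ≤ ‖S - P‖ := Complex.abs_im_le_norm _
  have hPS : ‖P - S‖ ≤ ε / 2 := by rw [norm_sub_rev]; exact herr
  refine ⟨?_, ?_⟩
  · have h1 : S.re = P.re - (P - S).re := by simp
    rw [h1]
    linarith [hP.1]
  · have h2 : S.im = (S - P).im + P.im := by simp
    rw [h2, hP.2, add_zero]
    linarith [herr]

end RpAssembly

end Summit.QuantumFields.QCD.Cruxes.StableActionBridge.Sketch

end
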